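import Summits.CriticalPhenomena.PercolationContinuityZ3.Theorems.PercNearOneGluingAdditiveGluingDKernelOfBlockGood
import Summits.CriticalPhenomena.PercolationContinuityZ3.Theorems.PercNearOneGluingAdditiveGluingDKernelInterp
import Summits.CriticalPhenomena.PercolationContinuityZ3.Theorems.PercNearOneGluingAdditiveGluingInterpSwitchReduction
import HarnessLib

/-! # Crux `PercNearOneGluing.AdditiveGluing` (stmt-CriticalPhenomena-4576) — reduction of the crux to a certificate on the residual class
# of the DESIGNATED-POCKET kernel calculus (leaf · `A.card ≤ 3` · isolated · interpolation switch), seat (d) round 4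

Support file (`--supports stmt-CriticalPhenomena-4576`); no definitions, no named facts.  CONDITIONAL result (hypothesis spelled out).

The D-line: `AdditiveGluing ⟸ D(u,S,a₀) ≥ 0` for every weighting `u`, block `S` of non-relays and un-glued minimiser `a₀`
(`additiveGluing_of_dcone`), where `D(u,S,a₀) : μ_{u/S}((S↔A) ∩ (a₀↔b)) ≤ μ_{u/S}(S↔b)`.  Because `D` is EXACTLY affine in every
pair weight (`dKernel_interp`), a strong induction on `#positive pairs + #fractional pairs` needs NO outer induction on vertices:
* `S = ∅`: trivial;  isolated block / `A.card ≤ 3`: block goodness is landed (`stub_isolatedBlock_c5`, `blockGood_cardLeThree_inf`) and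
  implies `D` (`dKernel_of_blockGood`);  leaf (`μ_u(a₀↔b) ≤ μ_u(v↔b)`, `v ∈ S`): Lemma 5 (`dKernel_of_leaf`);
* interpolation switch: some fractional pair `e` and minimisers `d₀, d₁` of `μ_{u[e↦0]}(·↔b)`, `μ_{u[e↦1]}(·↔b)` over `A` with
  `κ_{u[e↦0]/S}(a₀) ≤ κ_{u[e↦0]/S}(d₀)` and `κ_{u[e↦1]/S}(a₀) ≤ κ_{u[e↦1]/S}(d₁)` (`κ_g(x) = μ_g((S↔A) ∩ (x↔b))`): the induction
  hypothesis at both endpoints and `dKernel_of_interpSwitch`.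
So a certificate is needed only on the class where all of these fail (`cone_dkernel_of_cert`), and
`additiveGluing_of_dcert : DCERT → AdditiveGluing`.  For three relays the landed `dKernel_three_of_knThm2` (KN Theorem 2 at the
designation) is a further closure available to whoever discharges the certificate.  Census of this seat (lab/dcert.py, ~60 adversarial
annealing chains, n ≤ 8, 3–4 relays, plus deletion switches and KN-2): no member of the residual class was found.
[cite: KozmaNitzan2024, §3.2 pp. 12–14, Lemma 5 p. 13, §5.3 p. 34, Question 9 p. 36]
-/

namespace Summit.CriticalPhenomena.PercolationContinuityZ3.Theorems

open MeasureTheory Set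
open Literature.Probability.LatticeModels (prodBernoulli)
open Literature.Probability.Percolation (BondConfig openConn openConnIn openGraph openCluster)
open scoped BigOperators

noncomputable section
open Classical

section DKernelReduction

open Literature.Probability.LatticeModels Literature.Probability.Percolation

variable {n : ℕ}

/-- **The designated-pocket kernel for every block, from a certificate on the residual class of the D-calculus** (strong induction on
`#positive pairs + #fractional pairs`).  [cite: KozmaNitzan2024, §3.2 pp. 12–14, §5.3 p. 34] -/
theorem cone_dkernel_of_cert
    (hG : ∀ (n : ℕ) (u : Sym2 (Fin n) → unitInterval) (A S : Finset (Fin n)) (b a₀ : Fin n),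
      b ∈ A → Disjoint S A → a₀ ∈ A →
      (∀ a ∈ A, (prodBernoulli u).real (openConn a₀ b) ≤ (prodBernoulli u).real (openConn a b)) →
      4 ≤ A.card →
      (∃ x ∈ S, ∃ y : Fin n, (u s(x, y) : ℝ) ≠ 0) →
      (∀ v ∈ S, (prodBernoulli u).real (openConn v b) < (prodBernoulli u).real (openConn a₀ b)) →
      -- every interpolation switch fails
      (∀ e : Sym2 (Fin n), 0 < (u e : ℝ) → (u e : ℝ) < 1 → ∀ d₀ ∈ A, ∀ d₁ ∈ A,
        (∀ a ∈ A, (prodBernoulli (Function.update u e 0)).real (openConn d₀ b) ≤ (prodBernoulli (Function.update u e 0)).real (openConn a b)) →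
        (∀ a ∈ A, (prodBernoulli (Function.update u e 1)).real (openConn d₁ b) ≤ (prodBernoulli (Function.update u e 1)).real (openConn a b)) →
        ¬ ((prodBernoulli (fun e' : Sym2 (Fin n) => if (∀ y ∈ e', y ∈ S) ∧ ¬ e'.IsDiag then 1 else Function.update u e 0 e')).real
                ((⋃ v ∈ S, ⋃ a ∈ A, openConn v a) ∩ openConn a₀ b)
              ≤ (prodBernoulli (fun e' : Sym2 (Fin n) => if (∀ y ∈ e', y ∈ S) ∧ ¬ e'.IsDiag then 1 else Function.update u e 0 e')).real
                ((⋃ v ∈ S, ⋃ a ∈ A, openConn v a) ∩ openConn d₀ b)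
           ∧ (prodBernoulli (fun e' : Sym2 (Fin n) => if (∀ y ∈ e', y ∈ S) ∧ ¬ e'.IsDiag then 1 else Function.update u e 1 e')).real
                ((⋃ v ∈ S, ⋃ a ∈ A, openConn v a) ∩ openConn a₀ b)
              ≤ (prodBernoulli (fun e' : Sym2 (Fin n) => if (∀ y ∈ e', y ∈ S) ∧ ¬ e'.IsDiag then 1 else Function.update u e 1 e')).real
                ((⋃ v ∈ S, ⋃ a ∈ A, openConn v a) ∩ openConn d₁ b))) →
      (prodBernoulli (fun e : Sym2 (Fin n) => if (∀ y ∈ e, y ∈ S) ∧ ¬ e.IsDiag then 1 else u e)).real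
          ((⋃ v ∈ S, ⋃ a ∈ A, openConn v a) ∩ openConn a₀ b)
        ≤ (prodBernoulli (fun e : Sym2 (Fin n) => if (∀ y ∈ e, y ∈ S) ∧ ¬ e.IsDiag then 1 else u e)).real
          (⋃ v ∈ S, openConn v b)) :
    ∀ (n : ℕ) (u : Sym2 (Fin n) → unitInterval) (A S : Finset (Fin n)) (b a₀ : Fin n),
      b ∈ A → Disjoint S A → a₀ ∈ A →
      (∀ a ∈ A, (prodBernoulli u).real (openConn a₀ b) ≤ (prodBernoulli u).real (openConn a b)) →
      (prodBernoulli (fun e : Sym2 (Fin n) => if (∀ y ∈ e, y ∈ S) ∧ ¬ e.IsDiag then 1 else u e)).real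
          ((⋃ v ∈ S, ⋃ a ∈ A, openConn v a) ∩ openConn a₀ b)
        ≤ (prodBernoulli (fun e : Sym2 (Fin n) => if (∀ y ∈ e, y ∈ S) ∧ ¬ e.IsDiag then 1 else u e)).real
          (⋃ v ∈ S, openConn v b) := by
  intro n u
  suffices H : ∀ (m : ℕ) (u : Sym2 (Fin n) → unitInterval),
      (Finset.univ.filter (fun e' : Sym2 (Fin n) => 0 < (u e' : ℝ))).card
        + (Finset.univ.filter (fun e' : Sym2 (Fin n) => 0 < (u e' : ℝ) ∧ (u e' : ℝ) < 1)).card = m →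
      ∀ (A S : Finset (Fin n)) (b a₀ : Fin n),
      b ∈ A → Disjoint S A → a₀ ∈ A →
      (∀ a ∈ A, (prodBernoulli u).real (openConn a₀ b) ≤ (prodBernoulli u).real (openConn a b)) →
      (prodBernoulli (fun e : Sym2 (Fin n) => if (∀ y ∈ e, y ∈ S) ∧ ¬ e.IsDiag then 1 else u e)).real
          ((⋃ v ∈ S, ⋃ a ∈ A, openConn v a) ∩ openConn a₀ b)
        ≤ (prodBernoulli (fun e : Sym2 (Fin n) => if (∀ y ∈ e, y ∈ S) ∧ ¬ e.IsDiag then 1 else u e)).real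
          (⋃ v ∈ S, openConn v b) from
    fun A S b a₀ => H _ u rfl A S b a₀
  intro m
  induction m using Nat.strong_induction_on with
  | _ m ih =>
  intro u hm A S b a₀ hb hSA ha₀ hmin
  have hbS : b ∉ S := fun h => Finset.disjoint_left.1 hSA h hb
  -- empty block
  by_cases hSne : S.Nonempty
  swap
  · rw [Finset.not_nonempty_iff_eq_empty.1 hSne]
    simp
  -- isolated block: block goodness is landed, and block goodness implies the kernel
  by_cases hiso : ∀ v ∈ S, ∀ y : Fin n, (u s(y, v) : ℝ) = 0
  · exact dKernel_of_blockGood u A S b a₀ hb hSne ha₀ (stub_isolatedBlock_c5 n u A S b a₀ hb hSA ha₀ hmin hiso)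
  have hex : ∃ x ∈ S, ∃ y : Fin n, (u s(x, y) : ℝ) ≠ 0 := by
    push Not at hiso
    obtain ⟨v, hv, y, hy⟩ := hiso
    refine ⟨v, hv, y, ?_⟩
    rw [Sym2.eq_swap]
    exact hy
  -- at most two relays besides the target
  by_cases hA3 : A.card ≤ 3
  · exact dKernel_of_blockGood u A S b a₀ hb hSne ha₀ (blockGood_cardLeThree_inf u A S b a₀ hb ha₀ hA3 hSne hmin)
  have hA4 : 4 ≤ A.card := by omega
  -- leaf (Lemma 5)
  by_cases hleaf : ∃ v ∈ S, (prodBernoulli u).real (openConn a₀ b) ≤ (prodBernoulli u).real (openConn v b)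
  · obtain ⟨v, hv, hle⟩ := hleaf
    exact dKernel_of_leaf u A S b a₀ v hv hbS hle
  -- interpolation switch (induction hypothesis at both endpoints)
  by_cases his : ∃ e : Sym2 (Fin n), 0 < (u e : ℝ) ∧ (u e : ℝ) < 1 ∧ ∃ d₀ ∈ A, ∃ d₁ ∈ A,
      (∀ a ∈ A, (prodBernoulli (Function.update u e 0)).real (openConn d₀ b) ≤ (prodBernoulli (Function.update u e 0)).real (openConn a b)) ∧
      (∀ a ∈ A, (prodBernoulli (Function.update u e 1)).real (openConn d₁ b) ≤ (prodBernoulli (Function.update u e 1)).real (openConn a b)) ∧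
      (prodBernoulli (fun e' : Sym2 (Fin n) => if (∀ y ∈ e', y ∈ S) ∧ ¬ e'.IsDiag then 1 else Function.update u e 0 e')).real
          ((⋃ v ∈ S, ⋃ a ∈ A, openConn v a) ∩ openConn a₀ b)
        ≤ (prodBernoulli (fun e' : Sym2 (Fin n) => if (∀ y ∈ e', y ∈ S) ∧ ¬ e'.IsDiag then 1 else Function.update u e 0 e')).real
          ((⋃ v ∈ S, ⋃ a ∈ A, openConn v a) ∩ openConn d₀ b) ∧
      (prodBernoulli (fun e' : Sym2 (Fin n) => if (∀ y ∈ e', y ∈ S) ∧ ¬ e'.IsDiag then 1 else Function.update u e 1 e')).real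
          ((⋃ v ∈ S, ⋃ a ∈ A, openConn v a) ∩ openConn a₀ b)
        ≤ (prodBernoulli (fun e' : Sym2 (Fin n) => if (∀ y ∈ e', y ∈ S) ∧ ¬ e'.IsDiag then 1 else Function.update u e 1 e')).real
          ((⋃ v ∈ S, ⋃ a ∈ A, openConn v a) ∩ openConn d₁ b)
  · obtain ⟨e, he0, he1, d₀, hd₀, d₁, hd₁, hd₀min, hd₁min, hle0, hle1⟩ := his
    have hlt0 := interpSw_measure_update_zero_lt u e (ne_of_gt he0)
    have hlt1 := interpSw_measure_update_one_lt u e he0 he1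
    rw [hm] at hlt0 hlt1
    exact dKernel_of_interpSwitch u A S b a₀ d₀ d₁ e hle0 hle1
      (ih _ hlt0 (Function.update u e 0) rfl A S b d₀ hb hSA hd₀ hd₀min)
      (ih _ hlt1 (Function.update u e 1) rfl A S b d₁ hb hSA hd₁ hd₁min)
  -- the residual class: use the certificate
  have hbad : ∀ v ∈ S, (prodBernoulli u).real (openConn v b) < (prodBernoulli u).real (openConn a₀ b) := by
    intro v hv
    by_contra h
    exact hleaf ⟨v, hv, not_lt.1 h⟩
  have hinterp : ∀ e : Sym2 (Fin n), 0 < (u e : ℝ) → (u e : ℝ) < 1 → ∀ d₀ ∈ A, ∀ d₁ ∈ A,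
      (∀ a ∈ A, (prodBernoulli (Function.update u e 0)).real (openConn d₀ b) ≤ (prodBernoulli (Function.update u e 0)).real (openConn a b)) →
      (∀ a ∈ A, (prodBernoulli (Function.update u e 1)).real (openConn d₁ b) ≤ (prodBernoulli (Function.update u e 1)).real (openConn a b)) →
      ¬ ((prodBernoulli (fun e' : Sym2 (Fin n) => if (∀ y ∈ e', y ∈ S) ∧ ¬ e'.IsDiag then 1 else Function.update u e 0 e')).real
              ((⋃ v ∈ S, ⋃ a ∈ A, openConn v a) ∩ openConn a₀ b)
            ≤ (prodBernoulli (fun e' : Sym2 (Fin n) => if (∀ y ∈ e', y ∈ S) ∧ ¬ e'.IsDiag then 1 else Function.update u e 0 e')).real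
              ((⋃ v ∈ S, ⋃ a ∈ A, openConn v a) ∩ openConn d₀ b)
         ∧ (prodBernoulli (fun e' : Sym2 (Fin n) => if (∀ y ∈ e', y ∈ S) ∧ ¬ e'.IsDiag then 1 else Function.update u e 1 e')).real
              ((⋃ v ∈ S, ⋃ a ∈ A, openConn v a) ∩ openConn a₀ b)
            ≤ (prodBernoulli (fun e' : Sym2 (Fin n) => if (∀ y ∈ e', y ∈ S) ∧ ¬ e'.IsDiag then 1 else Function.update u e 1 e')).real
              ((⋃ v ∈ S, ⋃ a ∈ A, openConn v a) ∩ openConn d₁ b)) := by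
    intro e he0 he1 d₀ hd₀ d₁ hd₁ hd₀min hd₁min h
    exact his ⟨e, he0, he1, d₀, hd₀, d₁, hd₁, hd₀min, hd₁min, h.1, h.2⟩
  exact hG n u A S b a₀ hb hSA ha₀ hmin hA4 hex hbad hinterp

/-- **`AdditiveGluing` from a certificate on the residual class of the D-calculus** (crux statement unfolded).
[cite: KozmaNitzan2024, §3.2 pp. 12–14, Question 9 p. 36] -/
theorem additiveGluing_of_dcert
    (hG : ∀ (n : ℕ) (u : Sym2 (Fin n) → unitInterval) (A S : Finset (Fin n)) (b a₀ : Fin n),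
      b ∈ A → Disjoint S A → a₀ ∈ A →
      (∀ a ∈ A, (prodBernoulli u).real (openConn a₀ b) ≤ (prodBernoulli u).real (openConn a b)) →
      4 ≤ A.card →
      (∃ x ∈ S, ∃ y : Fin n, (u s(x, y) : ℝ) ≠ 0) →
      (∀ v ∈ S, (prodBernoulli u).real (openConn v b) < (prodBernoulli u).real (openConn a₀ b)) →
      (∀ e : Sym2 (Fin n), 0 < (u e : ℝ) → (u e : ℝ) < 1 → ∀ d₀ ∈ A, ∀ d₁ ∈ A,
        (∀ a ∈ A, (prodBernoulli (Function.update u e 0)).real (openConn d₀ b) ≤ (prodBernoulli (Function.update u e 0)).real (openConn a b)) →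
        (∀ a ∈ A, (prodBernoulli (Function.update u e 1)).real (openConn d₁ b) ≤ (prodBernoulli (Function.update u e 1)).real (openConn a b)) →
        ¬ ((prodBernoulli (fun e' : Sym2 (Fin n) => if (∀ y ∈ e', y ∈ S) ∧ ¬ e'.IsDiag then 1 else Function.update u e 0 e')).real
                ((⋃ v ∈ S, ⋃ a ∈ A, openConn v a) ∩ openConn a₀ b)
              ≤ (prodBernoulli (fun e' : Sym2 (Fin n) => if (∀ y ∈ e', y ∈ S) ∧ ¬ e'.IsDiag then 1 else Function.update u e 0 e')).real
                ((⋃ v ∈ S, ⋃ a ∈ A, openConn v a) ∩ openConn d₀ b)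
           ∧ (prodBernoulli (fun e' : Sym2 (Fin n) => if (∀ y ∈ e', y ∈ S) ∧ ¬ e'.IsDiag then 1 else Function.update u e 1 e')).real
                ((⋃ v ∈ S, ⋃ a ∈ A, openConn v a) ∩ openConn a₀ b)
              ≤ (prodBernoulli (fun e' : Sym2 (Fin n) => if (∀ y ∈ e', y ∈ S) ∧ ¬ e'.IsDiag then 1 else Function.update u e 1 e')).real
                ((⋃ v ∈ S, ⋃ a ∈ A, openConn v a) ∩ openConn d₁ b))) →
      (prodBernoulli (fun e : Sym2 (Fin n) => if (∀ y ∈ e, y ∈ S) ∧ ¬ e.IsDiag then 1 else u e)).real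
          ((⋃ v ∈ S, ⋃ a ∈ A, openConn v a) ∩ openConn a₀ b)
        ≤ (prodBernoulli (fun e : Sym2 (Fin n) => if (∀ y ∈ e, y ∈ S) ∧ ¬ e.IsDiag then 1 else u e)).real
          (⋃ v ∈ S, openConn v b)) :
    ∀ (n : ℕ) (w : Sym2 (Fin n) → unitInterval) (A : Finset (Fin n)) (o b : Fin n) (t : ℝ), 0 ≤ t →
      (∀ a ∈ A, 1 - t ≤ (prodBernoulli w).real (openConn a b)) →
      (prodBernoulli w).real (⋃ a ∈ A, openConn o a) - t ≤ (prodBernoulli w).real (openConn o b) :=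
  additiveGluing_of_dcone (cone_dkernel_of_cert hG)

end DKernelReduction

end

end Summit.CriticalPhenomena.PercolationContinuityZ3.Theorems
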